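import Summits.BirchSwinnertonDyer.BirchSwinnertonDyer.Theorems.ResidualThetaTransportAtTwoResidualSignedLambdaLowerCMAtTwoFourTermOneSided
import Summits.BirchSwinnertonDyer.BirchSwinnertonDyer.Theorems.ResidualThetaTransportAtTwoLambdaLowerBoundOWeierstrass
import HarnessLib

/-!
# Sketch (stub-ideation k3 g21, `stub_cmLambdaLower`, crux stmt-BirchSwinnertonDyer-26074) — DECOMPOSITION of H0
# «generator of the zeta line up to a constant» into three sub-stubs with PROVED glue (and proved pieces)

BSD is NOT proved by anything here; RSL_g (stmt-22608) and (R≥)ᵖ (stmt-26074) stay OPEN. Nothing about any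
curve or form is asserted: pure commutative algebra over `Λ = A⟦X⟧`, `A` a complete DVR with uniformiser `ϖ`.

TARGET. The `(ii)`-half adapter `SideaK2G16.ii_clauses_of_package` (Cruxes/…/Sketch_sidea_k2_g16.lean) of the
S3″ discharge takes as HYPOTHESES an element `z₀ ∈ Z` without `Λ`-torsion and a constant `c₀ ∈ A ∖ 0` with
`c₀ • Z ≤ Λ z₀` («`Z_Γ ⊗ ℚ` principal: Kato 12.4 (2)(3) + PID `A⟦X⟧[1/ϖ]`»); card k2-g16 left the supplying
lemma H0 `exists_generator_upTo_const` SIGNATURE-ONLY («the only unproved algebra»). This file splits H0 as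

  H0a `exists_eq_C_pow_mul_map_residue_ne_zero`   (μ-split: `r ≠ 0 ⇒ r = C ϖᵏ · r₁`, `r₁ ≢ 0 mod ϖ`)
  H0b `exists_eq_span_singleton_of_saturated`      (a `ϖ`-SATURATED non-zero ideal of `A⟦X⟧` is principal —
                                                    Weierstrass DIVISION by a minimal-degree element, Mathlib
                                                    `PowerSeries.eq_mul_weierstrassDiv_add_weierstrassMod`)
  H0c `exists_C_mul_mem_span_singleton_of_ne_bot`  (every non-zero ideal `J` is principal up to a constant:
                                                    `∃ j ∈ J, K : C ϖᴷ · J ≤ (j)`, via the saturation of `J`)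
  glue `exists_generator_upTo_const`               (H0c along the tree embedding `H ↪ Λ` of a f.g. torsion-free
                                                    rank-one module, `Module.exists_injective_linearMap_of_rank_le_one`)
  plug `generator_upTo_const_of_package`           (Kato-package currency: discharges the binders
                                                    `z₀ hz₀ hz₀tf c₀ hc₀ hgen` of `ii_clauses_of_package` from the
                                                    three outputs of K0b `Kato2004.thm12_4_newform` and `P.isTorsion_quotient`)

All five are PROVED below (no `sorry`).
-/

set_option autoImplicit false
set_option linter.dupNamespace false

noncomputable section

open scoped Classical

namespace Summit.BirchSwinnertonDyer.BirchSwinnertonDyer.Cruxes.ResidualThetaCountLowerPureAtTwo.SideaK3G21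

open Literature.NumberTheory.EllipticCurves Literature.NumberTheory.EllipticCurves.Kato2004
open Literature.NumberTheory.GaloisRepresentations
open Summit.BirchSwinnertonDyer.BirchSwinnertonDyer.Theorems

/-! ## §1 (H0a) `ϖ`-content of a non-zero power series over a DVR -/

section DVR

variable {A : Type*} [CommRing A] [IsDomain A] [IsDiscreteValuationRing A]

/-- **H0a (μ-split).** Every non-zero `r ∈ A⟦X⟧` (`A` a DVR, uniformiser `ϖ`) is `C ϖᵏ · r₁` with `r₁ ≢ 0 (mod ϖ)`
(`k` = the least valuation of a coefficient). The `𝒪`-twin of the tree's `IwasawaAlgebra.exists_eq_pow_mul_of_ne_zero`.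
[cite: Washington1997, §7.1 (proof of Thm. 7.3)] -/
theorem exists_eq_C_pow_mul_map_residue_ne_zero {ϖ : A} (hϖ : Irreducible ϖ) {r : PowerSeries A} (hr : r ≠ 0) :
    ∃ (k : ℕ) (r₁ : PowerSeries A), r = PowerSeries.C (ϖ ^ k) * r₁ ∧
      PowerSeries.map (IsLocalRing.residue A) r₁ ≠ 0 := by
  -- a non-zero coefficient bounds the `ϖ`-divisibility of `r`
  obtain ⟨i₀, hi₀⟩ : ∃ i, PowerSeries.coeff i r ≠ 0 := by
    by_contra h
    push Not at h
    exact hr (PowerSeries.ext fun i => by rw [h i, map_zero])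
  obtain ⟨n, u, hu⟩ := IsDiscreteValuationRing.eq_unit_mul_pow_irreducible hi₀ hϖ
  have hbound : ∀ k, PowerSeries.C (ϖ ^ k) ∣ r → k ≤ n := by
    rintro k ⟨s, hs⟩
    by_contra hk
    push Not at hk
    have h1 : PowerSeries.coeff i₀ r = ϖ ^ k * PowerSeries.coeff i₀ s := by
      rw [hs, PowerSeries.coeff_C_mul]
    have h2 : ϖ ^ (n + 1) ∣ (u : A) * ϖ ^ n := by
      rw [← hu, h1]
      exact (pow_dvd_pow ϖ (by omega)).mul_right _
    rw [pow_succ, mul_comm (u : A) (ϖ ^ n)] at h2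
    have h3 : ϖ ∣ (u : A) := (mul_dvd_mul_iff_left (pow_ne_zero n hϖ.ne_zero)).mp h2
    exact hϖ.not_isUnit (isUnit_of_dvd_unit h3 u.isUnit)
  -- the largest `k` with `C ϖᵏ ∣ r`
  have hex : ∃ m, ¬ PowerSeries.C (ϖ ^ (m + 1)) ∣ r := ⟨n, fun h => by have := hbound _ h; omega⟩
  obtain ⟨k, hk_spec, hk_min⟩ : ∃ k, ¬ PowerSeries.C (ϖ ^ (k + 1)) ∣ r ∧
      ∀ m, m < k → PowerSeries.C (ϖ ^ (m + 1)) ∣ r :=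
    ⟨Nat.find hex, Nat.find_spec hex, fun m hm => not_not.mp (Nat.find_min hex hm)⟩
  have hPk : PowerSeries.C (ϖ ^ k) ∣ r := by
    cases k with
    | zero => simp
    | succ m => exact hk_min m (lt_add_one m)
  obtain ⟨r₁, hr₁⟩ := hPk
  refine ⟨k, r₁, hr₁, fun hres => hk_spec ?_⟩
  obtain ⟨r₂, hr₂⟩ := CharIdealLambda.C_dvd_of_map_residue_eq_zero hϖ hres
  exact ⟨r₂, by rw [hr₁, hr₂, pow_succ, map_mul, mul_assoc]⟩

/-! ## §2 (H0b) A `ϖ`-saturated non-zero ideal of `A⟦X⟧` is principal (Weierstrass division) -/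

variable [IsAdicComplete (IsLocalRing.maximalIdeal A) A]

/-- **H0b (saturated ⇒ principal).** For `A` a complete DVR, a non-zero ideal `J ≤ A⟦X⟧` with `C ϖ · x ∈ J ⇒ x ∈ J`
is principal, generated by any `f ∈ J` of non-zero reduction and minimal Weierstrass degree: the Weierstrass
remainder of `g ∈ J` modulo `f` lies in `J`, and after dividing out its `ϖ`-content it would have smaller degree.
(Equivalently: `A⟦X⟧[1/ϖ]` is a PID and `J = J[1/ϖ] ∩ A⟦X⟧`.) [cite: Washington1997, Prop. 7.2, §13.2] -/
theorem exists_eq_span_singleton_of_saturated {ϖ : A} (hϖ : Irreducible ϖ) {J : Ideal (PowerSeries A)}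
    (hJ : J ≠ ⊥) (hsat : ∀ x, PowerSeries.C ϖ * x ∈ J → x ∈ J) :
    ∃ f ∈ J, PowerSeries.map (IsLocalRing.residue A) f ≠ 0 ∧ J = Ideal.span {f} := by
  have hsat' : ∀ (k : ℕ) (x : PowerSeries A), PowerSeries.C (ϖ ^ k) * x ∈ J → x ∈ J := by
    intro k
    induction k with
    | zero => intro x hx; simpa using hx
    | succ k ih =>
      intro x hx
      refine ih _ (hsat _ ?_)
      rwa [← mul_assoc, ← map_mul, ← pow_succ']
  -- `J` has an element of non-zero reduction; take one of minimal Weierstrass degree `n`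
  have hex : ∃ n, ∃ f ∈ J, PowerSeries.map (IsLocalRing.residue A) f ≠ 0 ∧
      (PowerSeries.map (IsLocalRing.residue A) f).order.toNat = n := by
    obtain ⟨x, hxJ, hx0⟩ := Submodule.exists_mem_ne_zero_of_ne_bot hJ
    obtain ⟨k, x₁, hx, hx₁⟩ := exists_eq_C_pow_mul_map_residue_ne_zero hϖ hx0
    exact ⟨_, x₁, hsat' k x₁ (hx ▸ hxJ), hx₁, rfl⟩
  obtain ⟨n, ⟨f, hfJ, hf, hfn⟩, hmin⟩ : ∃ n, (∃ f ∈ J, PowerSeries.map (IsLocalRing.residue A) f ≠ 0 ∧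
      (PowerSeries.map (IsLocalRing.residue A) f).order.toNat = n) ∧
      ∀ m, m < n → ¬ ∃ f ∈ J, PowerSeries.map (IsLocalRing.residue A) f ≠ 0 ∧
        (PowerSeries.map (IsLocalRing.residue A) f).order.toNat = m :=
    ⟨Nat.find hex, Nat.find_spec hex, fun m hm => Nat.find_min hex hm⟩
  refine ⟨f, hfJ, hf, le_antisymm (fun g hg => ?_) ((Ideal.span_singleton_le_iff_mem _).mpr hfJ)⟩
  -- Weierstrass division of `g ∈ J` by `f`
  have hdiv := PowerSeries.eq_mul_weierstrassDiv_add_weierstrassMod g hf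
  have hdeg := PowerSeries.degree_weierstrassMod_lt g f
  have hrJ : ((g %ʷ f : Polynomial A) : PowerSeries A) ∈ J := by
    have e : ((g %ʷ f : Polynomial A) : PowerSeries A) = g - f * (g /ʷ f) := by
      rw [eq_sub_iff_add_eq, add_comm, ← hdiv]
    rw [e]
    exact J.sub_mem hg (J.mul_mem_right _ hfJ)
  by_cases hr0 : ((g %ʷ f : Polynomial A) : PowerSeries A) = 0
  · rw [hr0, add_zero] at hdiv
    rw [hdiv]
    exact Ideal.mul_mem_right _ _ (Ideal.mem_span_singleton_self f)
  · exfalso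
    obtain ⟨k, r₁, hr, hr₁⟩ := exists_eq_C_pow_mul_map_residue_ne_zero hϖ hr0
    have hr₁J : r₁ ∈ J := hsat' k r₁ (hr ▸ hrJ)
    -- the coefficients of `r₁` vanish from `n` on
    have hcoeff : ∀ i, n ≤ i → PowerSeries.coeff i r₁ = 0 := by
      intro i hi
      have h1 : PowerSeries.coeff i (((g %ʷ f : Polynomial A) : PowerSeries A)) = 0 := by
        rw [Polynomial.coeff_coe]
        apply Polynomial.coeff_eq_zero_of_degree_lt
        refine lt_of_lt_of_le hdeg ?_
        rw [hfn]
        exact_mod_cast hi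
      rw [hr, PowerSeries.coeff_C_mul] at h1
      exact (mul_eq_zero.mp h1).resolve_left (pow_ne_zero _ hϖ.ne_zero)
    -- hence the reduction of `r₁` is non-zero of order `< n`: contradiction with minimality
    obtain ⟨i, hi⟩ : ∃ i, PowerSeries.coeff i (PowerSeries.map (IsLocalRing.residue A) r₁) ≠ 0 := by
      by_contra h
      push Not at h
      exact hr₁ (PowerSeries.ext fun i => by rw [h i, map_zero])
    have hin : i < n := by
      by_contra h
      push Not at h
      exact hi (by rw [PowerSeries.coeff_map, hcoeff i h, map_zero])
    have hord : (PowerSeries.map (IsLocalRing.residue A) r₁).order.toNat < n :=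
      lt_of_le_of_lt (ENat.toNat_le_of_le_coe (PowerSeries.order_le i hi)) hin
    exact hmin _ hord ⟨r₁, hr₁J, hr₁, rfl⟩

/-! ## §3 (H0c) Every non-zero ideal of `A⟦X⟧` is principal up to a constant -/

/-- **H0c (principal up to a constant).** For `A` a complete DVR and `J ≤ A⟦X⟧` a non-zero ideal there are
`j ∈ J ∖ 0` and `c ∈ A ∖ 0` with `C c · J ≤ (j)`: apply H0b to the `ϖ`-saturation `J' = {x | ∃ k, C ϖᵏ x ∈ J} = (f)`
and take `j = C ϖᴷ f ∈ J`, `c = ϖᴷ`. [cite: Washington1997, §13.2] [cite: Kato2004Asterisque, §13.8 (Λ ⊗ ℚ is a PID)] -/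
theorem exists_C_mul_mem_span_singleton_of_ne_bot {J : Ideal (PowerSeries A)} (hJ : J ≠ ⊥) :
    ∃ j ∈ J, j ≠ 0 ∧ ∃ c : A, c ≠ 0 ∧ ∀ x ∈ J, PowerSeries.C c * x ∈ Ideal.span {j} := by
  obtain ⟨ϖ, hϖ⟩ := IsDiscreteValuationRing.exists_irreducible A
  -- the `ϖ`-saturation of `J`
  let Jsat : Ideal (PowerSeries A) :=
    { carrier := {x | ∃ k : ℕ, PowerSeries.C (ϖ ^ k) * x ∈ J}
      add_mem' := by
        rintro x y ⟨k, hk⟩ ⟨l, hl⟩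
        refine ⟨k + l, ?_⟩
        have e : PowerSeries.C (ϖ ^ (k + l)) * (x + y) =
            PowerSeries.C (ϖ ^ l) * (PowerSeries.C (ϖ ^ k) * x) +
              PowerSeries.C (ϖ ^ k) * (PowerSeries.C (ϖ ^ l) * y) := by
          rw [pow_add, map_mul]; ring
        rw [e]
        exact J.add_mem (J.mul_mem_left _ hk) (J.mul_mem_left _ hl)
      zero_mem' := ⟨0, by simp⟩
      smul_mem' := by
        rintro c x ⟨k, hk⟩
        refine ⟨k, ?_⟩
        rw [smul_eq_mul, mul_left_comm]
        exact J.mul_mem_left c hk }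
  have hle : J ≤ Jsat := fun x hx => ⟨0, by simpa using hx⟩
  have hsat_ne : Jsat ≠ ⊥ := fun h => hJ (le_bot_iff.mp (hle.trans h.le))
  have hsat : ∀ x, PowerSeries.C ϖ * x ∈ Jsat → x ∈ Jsat := by
    rintro x ⟨k, hk⟩
    exact ⟨k + 1, by rwa [pow_succ, map_mul, mul_assoc]⟩
  obtain ⟨f, hf_mem, hf, hgen⟩ := exists_eq_span_singleton_of_saturated hϖ hsat_ne hsat
  obtain ⟨K, hK⟩ := hf_mem
  have hf0 : f ≠ 0 := fun h => hf (by rw [h, map_zero])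
  have hCK : (PowerSeries.C (ϖ ^ K) : PowerSeries A) ≠ 0 := fun h =>
    pow_ne_zero K hϖ.ne_zero (PowerSeries.C_injective (by rw [h, map_zero]))
  refine ⟨PowerSeries.C (ϖ ^ K) * f, hK, mul_ne_zero hCK hf0, ϖ ^ K, pow_ne_zero _ hϖ.ne_zero,
    fun x hx => ?_⟩
  have hx' : x ∈ Ideal.span {f} := by
    rw [← hgen]
    exact hle hx
  obtain ⟨y, hy⟩ := Ideal.mem_span_singleton'.mp hx'
  refine Ideal.mem_span_singleton'.mpr ⟨y, ?_⟩
  rw [← hy]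
  ring

/-! ## §4 (glue, proved) H0 for a submodule of a f.g. torsion-free rank-one `A⟦X⟧`-module -/

/-- **H0 (generator up to a constant)** — the statement card k2-g16 left signature-only, over `Λ = A⟦X⟧` (`A` a
complete DVR): a non-zero submodule `Z` of a finitely generated torsion-free `Λ`-module `H` of rank one contains a
torsion-free `z₀` with `C c₀ • Z ≤ Λ z₀` for a constant `c₀ ∈ A ∖ 0`. GLUE: H0c transported along an embedding
`H ↪ Λ` (tree `Module.exists_injective_linearMap_of_rank_le_one`). [cite: Kato2004Asterisque, Thm. 12.4 (2), §13.8] -/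
theorem exists_generator_upTo_const {H : Type*} [AddCommGroup H] [Module (PowerSeries A) H]
    [Module.Finite (PowerSeries A) H] [Module.IsTorsionFree (PowerSeries A) H]
    (hrk : Module.rank (PowerSeries A) H = 1) (Z : Submodule (PowerSeries A) H) (hZ : Z ≠ ⊥) :
    ∃ z₀ ∈ Z, (∀ a : PowerSeries A, a • z₀ = 0 → a = 0) ∧
      ∃ c₀ : A, c₀ ≠ 0 ∧ ∀ z ∈ Z, PowerSeries.C c₀ • z ∈ Submodule.span (PowerSeries A) {z₀} := by
  obtain ⟨φ, hφ⟩ :=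
    Module.exists_injective_linearMap_of_rank_le_one (R := PowerSeries A) (M := H) hrk.le
  have hJ : Z.map φ ≠ ⊥ := by
    obtain ⟨z, hz, hz0⟩ := Submodule.exists_mem_ne_zero_of_ne_bot hZ
    exact (Submodule.ne_bot_iff _).mpr
      ⟨φ z, Submodule.mem_map_of_mem hz, fun h => hz0 (hφ (h.trans (map_zero φ).symm))⟩
  obtain ⟨j, hj, hj0, c, hc, hgen⟩ := exists_C_mul_mem_span_singleton_of_ne_bot hJ
  obtain ⟨z₀, hz₀, rfl⟩ := Submodule.mem_map.mp hj
  refine ⟨z₀, hz₀, fun a ha => ?_, c, hc, fun z hz => ?_⟩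
  · have h : a * φ z₀ = 0 := by rw [← smul_eq_mul, ← map_smul, ha, map_zero]
    exact (mul_eq_zero.mp h).resolve_right hj0
  · obtain ⟨y, hy⟩ := Ideal.mem_span_singleton'.mp (hgen (φ z) (Submodule.mem_map_of_mem hz))
    refine Submodule.mem_span_singleton.mpr ⟨y, hφ ?_⟩
    rw [map_smul, map_smul, smul_eq_mul, smul_eq_mul, hy]

omit [IsDiscreteValuationRing A] [IsAdicComplete (IsLocalRing.maximalIdeal A) A] in
/-- A submodule with torsion quotient of a non-zero torsion-free module is non-zero. [folklore] -/
theorem ne_bot_of_isTorsion_quotient {R : Type*} [CommRing R] [IsDomain R] {H : Type*} [AddCommGroup H]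
    [Module R H] [Module.IsTorsionFree R H] [Nontrivial H] (Z : Submodule R H)
    (hZ : Module.IsTorsion R (H ⧸ Z)) : Z ≠ ⊥ := by
  obtain ⟨h₀, hh₀⟩ := exists_ne (0 : H)
  obtain ⟨⟨a, ha⟩, hah⟩ := @hZ (Z.mkQ h₀)
  rw [Submonoid.mk_smul, Submodule.mkQ_apply, ← Submodule.Quotient.mk_smul,
    Submodule.Quotient.mk_eq_zero] at hah
  exact (Submodule.ne_bot_iff _).mpr ⟨a • h₀, hah, smul_ne_zero (nonZeroDivisors.ne_zero ha) hh₀⟩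

end DVR

/-! ## §5 (plug) Kato-package currency: the `z₀ hz₀ hz₀tf c₀ hc₀ hgen` binders of `SideaK2G16.ii_clauses_of_package` -/

/-- **Plug.** For Kato's package `P` on `𝐇¹_Γ(T)` over `A⟦X⟧` (`A` a complete DVR) with `𝐇¹_Γ` finitely generated,
torsion free of rank one (the three outputs of K0b `Kato2004.thm12_4_newform`): the zeta submodule `Z` has an
element `z₀` without `Λ`-torsion generating it up to a constant `c₀ ∈ A ∖ 0` — literally the binders
`(z₀) (hz₀) (hz₀tf) (c₀) (hc₀) (hgen)` of `SideaK2G16.ii_clauses_of_package`. BSD is not advanced; nothing is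
instantiated. [cite: Kato2004Asterisque, Thm. 12.4 (2), Thm. 12.5 (2), §13.8] -/
theorem generator_upTo_const_of_package {A : Type} [CommRing A] [TopologicalSpace A] [IsDomain A]
    [IsDiscreteValuationRing A] [IsAdicComplete (IsLocalRing.maximalIdeal A) A] {V : Type} [AddCommGroup V]
    [Module A V] [TopologicalSpace V] [IsTopologicalAddGroup V] [ContinuousSMul A V] {T : GaloisRep ℚ A V}
    {p : ℕ} [Fact p.Prime] {κ : ZpExtension ℚ p} {γ : Field.absoluteGaloisGroup ℚ} {I : IwasawaH1DataCoeff T p κ γ}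
    (hI : Module.Finite (PowerSeries A) I.H) (htf : Module.IsTorsionFree (PowerSeries A) I.H)
    (hrk : Module.rank (PowerSeries A) I.H = 1) [Module A I.H] [IsScalarTower A (PowerSeries A) I.H]
    (P : ZetaQuotientPackage I) :
    ∃ z₀ ∈ P.Z, (∀ a : PowerSeries A, a • z₀ = 0 → a = 0) ∧
      ∃ c₀ : A, c₀ ≠ 0 ∧ ∀ z ∈ P.Z, c₀ • z ∈ Submodule.span (PowerSeries A) {z₀} := by
  haveI := hI
  haveI := htf
  haveI : Nontrivial I.H := rank_pos_iff_nontrivial.mp (by rw [hrk]; exact zero_lt_one)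
  have hZ : P.Z ≠ ⊥ := ne_bot_of_isTorsion_quotient P.Z P.isTorsion_quotient
  obtain ⟨z₀, hz₀, htf₀, c₀, hc₀, hgen⟩ := exists_generator_upTo_const hrk P.Z hZ
  refine ⟨z₀, hz₀, htf₀, c₀, hc₀, fun z hz => ?_⟩
  have h := hgen z hz
  rwa [PowerSeries.C_eq_algebraMap, algebraMap_smul] at h

end Summit.BirchSwinnertonDyer.BirchSwinnertonDyer.Cruxes.ResidualThetaCountLowerPureAtTwo.SideaK3G21
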